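import Summits.ABC.ABC.Theorems.DefiniteXiFreyModularityIsModular
import Literature.NumberTheory.EllipticCurves.CongruentNumberCurveIsModular
import HarnessLib

/-!
# Crux `FreyModularity` (stmt-ABC-11340), line `Sketch`: the crux holds at the CM corner
# `(a, b) = (1, -2)` — `y² = x(x − 1)(x − 2) ≅ y² = x³ − x` carries a parametrisation datum

Support file for the crux `Summit.ABC.ABC.Theses.DefiniteXi.FreyModularity` ("for all coprime
`a, b` with `ab(a+b) ≠ 0` and `N = N_{E_(a,b)}`, `Nonempty (ModularParametrizationData (freyCurve a b) N)`"),
line `Sketch`, registered side stub `stub_freyModularityCorner` (reshape 6, lead `c50`): the body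
of the crux at the corner pair `(a, b) = (1, -2)` (`ab(a+b) = 2`), UNCONDITIONALLY.  The Frey
curve `E_(1,-2) : y² = x(x - 1)(x - 2)` is the translate `x ↦ x + 1` of the congruent number curve
`E₁ : y² = x³ - x` (`congruentNumberCurve_one_eq_smul_freyCurve`), which the tree proves modular
in the sense of BCDT (2) — `φ = η(4z)²η(8z)²` is a newform on `Γ₀(32)` with `aₙ(φ) = aₙ(E₁)` for
all `n`, and `N(E₁) = 32` (`exists_isNewformOf_congruentNumberCurve_one`,
`Literature/NumberTheory/EllipticCurves/CongruentNumberCurveIsModular.lean`, the first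
unconditional `BCDT.IsModular` instance of the tree); a newform is exactly a parametrisation datum
(`nonempty_modularParametrizationData_iff_isModularAt`: uniformisation, Manin constant and modular
degree are theorems of the tree), and both the datum and the conductor are invariant under
admissible changes of variables (`nonempty_modularParametrizationData_smul_iff`,
`conductorNorm_smul_rat`).  So the datum type of the crux is inhabited IN KIND for a Frey curve:
the six corner pairs `{|a|, |b|, |a+b|} = {1, 1, 2}` are the CM members (`j = 1728`) of the family,
and for them no modularity lifting is needed.  Nothing is defined; no named fact is used.

## References

* [Tunnell1983Congruent] J. B. Tunnell, Invent. Math. 72 (1983), 323–334, p. 325.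
* [BCDTJAMS2001] C. Breuil, B. Conrad, F. Diamond, R. Taylor, J. Amer. Math. Soc. 14 (2001),
  Introduction, condition (2).
-/

-- `Summit.<Summit>.<Problem>` is the mandated summit-side namespace (CONVENTIONS §2); for the
-- single-conjunct summit `ABC` the two coincide, so the duplicate `ABC.ABC` is deliberate.
set_option linter.dupNamespace false

noncomputable section

open scoped MatrixGroups

open Literature.NumberTheory.EllipticCurves
open Literature.NumberTheory.EllipticCurves.ModularForms
open Literature.NumberTheory.EllipticCurves.Tunnell1983
open WeierstrassCurve

namespace Summit.ABC.ABC.Theorems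

/-- **Registered side stub `stub_freyModularityCorner` (crux `FreyModularity`, line `Sketch`,
S13): the crux at `(a, b) = (1, -2)`.**  For every level `N` with `N_{E_(1,-2)} = N` the Frey curve
`E_(1,-2) : y² = x(x - 1)(x - 2)` carries a `ModularParametrizationData` at level `N`: it is the
translate of the congruent number curve `E₁ : y² = x³ - x` (conductor `32`, newform
`η(4z)²η(8z)²`, `exists_isNewformOf_congruentNumberCurve_one`), a newform is a datum
(`nonempty_modularParametrizationData_iff_isModularAt`), and datum and conductor are invariant
under changes of variables (`nonempty_modularParametrizationData_smul_iff`, `conductorNorm_smul_rat`).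
[cite: Tunnell1983Congruent, p. 325] [cite: BCDTJAMS2001, Introduction, condition (2)] -/
theorem stub_freyModularityCorner :
    ∀ (N : ℕ) [NeZero N], (freyCurve 1 (-2)).conductorNorm ℤ = N →
      Nonempty (ModularParametrizationData (freyCurve 1 (-2)) N) := by
  intro N _ hN
  haveI : (freyCurve 1 (-2)).IsElliptic := isElliptic_freyCurve (by norm_num)
  haveI := isElliptic_congruentNumberCurve_one
  have hE : congruentNumberCurve 1 = (⟨1, 1, 0, 0⟩ : VariableChange ℚ) • freyCurve 1 (-2) :=
    congruentNumberCurve_one_eq_smul_freyCurve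
  have hN' : (congruentNumberCurve 1).conductorNorm ℤ = N := by
    rw [hE, conductorNorm_smul_rat]; exact hN
  obtain ⟨f, hf⟩ := exists_isNewformOf_congruentNumberCurve_one N hN'
  have h1 : Nonempty (ModularParametrizationData (congruentNumberCurve 1) N) :=
    (nonempty_modularParametrizationData_iff_isModularAt (congruentNumberCurve 1) N).mpr ⟨f, hf⟩
  rw [hE] at h1
  exact (nonempty_modularParametrizationData_smul_iff (⟨1, 1, 0, 0⟩ : VariableChange ℚ)).mp h1

/-- **The crux `FreyModularity` holds on the corner pair `(1, -2)`** — its body with `a = 1`,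
`b = -2` (coprime, `ab(a+b) = 2 ≠ 0`), in the crux's own binder shape.
[cite: BCDTJAMS2001, Introduction, condition (2)] -/
theorem freyModularity_one_neg_two :
    IsCoprime (1 : ℤ) (-2) → (1 : ℤ) * (-2) * (1 + (-2)) ≠ 0 → ∀ (N : ℕ) [NeZero N],
      (freyCurve 1 (-2)).conductorNorm ℤ = N →
        Nonempty (ModularParametrizationData (freyCurve 1 (-2)) N) :=
  fun _ _ N _ hN ↦ stub_freyModularityCorner N hN

end Summit.ABC.ABC.Theorems

end
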